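import Literature.AlgebraicGeometry.ModuliOfAbelianVarieties.Lan2013.Sec53GeneralPELDegenerationData
import HarnessLib

/-!
# [Lan2013PELCompactifications] §5.3 — PROOF COMPANION of `Lan2013/Sec53GeneralPELDegenerationData.lean` (RULING TS-1: theorems only)

Discharges, from Mathlib alone, Prop. 5.3.1.2 ∕ 5.3.1.3 (ED. 2) and the «by definition» parts of Lemma 5.3.1.6 and of Def. 5.3.1.11 typed as named facts in the carpet
★ `Lan2013/Sec53GeneralPELDegenerationData.lean` (squad TS, block R9b, typer TS-t17):

* `Lan2013_5316_inclusions_holds : Lan2013_5316_inclusions` — (5.3.1.7) `U^ess_2 ⊂ U^ess ⊂ Z^ess ⊂ P^ess ⊂ G^ess`;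
* `Lan2013_5316_exact_h_holds : Lan2013_5316_exact_h` — (5.3.1.8): the induced automorphism `Gr₋₁(g)` of `Z₋₁/Z₋₂` for `g ∈ P^ess_Z`
  exists uniquely (constructed: `gr1Equiv`, via `Submodule.mapQ` of the restricted action and its inverse), and its kernel clause;
* `Lan2013_5316_exact_l_holds : Lan2013_5316_exact_l` — (5.3.1.9): `Gr₋₂(g)` (`gr2Equiv`), `Gr₀(g)` (`gr0Equiv`) and the kernel clause;
* `Lan2013_5316_exact_u_holds : Lan2013_5316_exact_u` — (5.3.1.10): for `g ∈ U^ess_Z` and a splitting `δ` the change of basis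
  `ẑ = δ⁻¹ ∘ g ∘ δ` (★ `ChangeOfBasis`) exists uniquely (built from `LinearEquiv.ofBijective δ`), `(ẑ₂₁, ẑ₁₀) = 0 ⇔ g ∈ U^ess_{2,Z}`, and the
  splitting-free formulas `ẑ₂₁ [v] = g v − v`, `ẑ₁₀ [w] = [g w − w]`;
* `Lan2013_53111_sequences_holds : Lan2013_53111_sequences` — the inclusions `H_{n,U^ess_2} ⊂ H_{n,U^ess} ⊂ H_{n,Z^ess} ⊂ H_{n,P^ess} ⊂ H_n`
  and the three normalities making `H_{n,G^ess_h}`, `H_{n,G^ess_l}`, `H_{n,U^ess_1}` quotient groups.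

* `Lan2013_5312_action_holds : Lan2013_5312_action` (ED. 2) — Prop. 5.3.1.2 ∕ 5.3.1.3: the translate of a linear level datum under `g`
  EXISTS (`exists_isTranslate`: `Z′ = g⁻¹Z`, the induced `Gr_{-i}(g) : Gr^{Z′}_{-i} ⥲ Gr^Z_{-i}` by `LinearMap.restrict` ∕ `Submodule.mapQ` +
  `LinearEquiv.ofLinear`, `ϕ′₋₂ = ν(g) ∘ ϕ₋₂ ∘ Gr₋₂(g)` through `DistribMulAction.toLinearEquiv`, `δ̂′ = g⁻¹ ∘ δ̂ ∘ Gr(g)` with its ★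
  `IsSplitting` re-derived), is UNIQUE (`isTranslate_unique`: dependent-record extensionality after `subst`), and the rules give a right
  action (`isTranslate_one`, `isTranslate_mul`).

Not discharged here (left as named facts): `Lan2013_5331_of` (Thm. 5.3.3.1, relative) and `Lan2013_5332_condition2` (Rem. 5.3.3.2) — deep.
THEOREMS ONLY: no `def`, no `sorry`, no `instance`, no notation; the witnesses of the existence clauses (`Gr_{-i}(g)` via `Submodule.mapQ` ∕
`LinearMap.restrict` + `LinearEquiv.ofLinear`, `ẑ` via `LinearEquiv.ofBijective`, the translate `a′`) are built INSIDE the proofs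
(Mathlib only).
HC_CM is proved only modulo the 7 printed citations (2 remaining: hLiu418 = stmt-HodgeConjecture-24832, h413 =
stmt-HodgeConjecture-24833) until rung 0 closes; this file discharges none of them.

## References
* [Lan2013PELCompactifications] K.-W. Lan, *Arithmetic compactifications of PEL-type Shimura varieties*, LMS Monographs 36 (2013),
  Prop. 5.3.1.2 ∕ 5.3.1.3 (p. 348), Lemma 5.3.1.6 with (5.3.1.7)–(5.3.1.10) and Def. 5.3.1.11 (p. 349); Def. 5.2.2.10 (2010 rev. p. 335).
-/

noncomputable section

open scoped Pointwise
open Literature.AlgebraicGeometry.ModuliOfAbelianVarieties.Lan2013.Sec522FiltrationsSplittings (Filtration3 ChangeOfBasis)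

namespace Literature.AlgebraicGeometry.ModuliOfAbelianVarieties.Lan2013.Sec53GeneralPELDegenerationData

universe u v w u₁ u₂ u₃ u₄ u₅

section MemLemmas

variable {A : Type u} [CommRing A] {M : Type v} [AddCommGroup M] [Module A M]
  {Γ : Type w} [Group Γ] [DistribMulAction Γ M] [SMulCommClass Γ A M]
  {C : Type u₁} [CommGroup C] (ν : Γ →* C) (Z : Filtration3 A M)

/-- Membership in `P^ess_Z`: `g` stabilises `Z₋₂` and `Z₋₁`. [cite: Lan2013PELCompactifications, Def. 5.3.1.4 (pp. 348–349)] -/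
theorem mem_stabP_iff {g : Γ} : g ∈ stabP Γ Z ↔ g • Z.Z2 = Z.Z2 ∧ g • Z.Z1 = Z.Z1 := by
  simp only [stabP, Subgroup.mem_inf, MulAction.mem_stabilizer_iff]

/-- Membership in `Z^ess_Z` (definitional unfolding). [cite: Lan2013PELCompactifications, Def. 5.3.1.4 (pp. 348–349)] -/
theorem mem_Zess_iff {g : Γ} : g ∈ Zess ν Z ↔ g ∈ stabP Γ Z ∧ ν g = 1 ∧ ∀ v ∈ Z.Z1, g • v - v ∈ Z.Z2 := Iff.rfl

/-- Membership in `U^ess_Z` (definitional unfolding). [cite: Lan2013PELCompactifications, Def. 5.3.1.4 (pp. 348–349)] -/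
theorem mem_Uess_iff {g : Γ} : g ∈ Uess ν Z ↔ g ∈ Zess ν Z ∧ (∀ u ∈ Z.Z2, g • u = u) ∧ ∀ w : M, g • w - w ∈ Z.Z1 :=
  Iff.rfl

/-- Membership in `U^ess_{2,Z}` (definitional unfolding). [cite: Lan2013PELCompactifications, Def. 5.3.1.4 (pp. 348–349)] -/
theorem mem_U2grp_iff {g : Γ} : g ∈ U2grp ν Z ↔ g ∈ Uess ν Z ∧ (∀ v ∈ Z.Z1, g • v = v) ∧ ∀ w : M, g • w - w ∈ Z.Z2 :=
  Iff.rfl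

/-- `g ∈ P^ess_Z` maps `Z₋₂` into itself. [cite: Lan2013PELCompactifications, Def. 5.3.1.4 (pp. 348–349)] -/
theorem smul_mem_Z2_of_mem_stabP {g : Γ} (hg : g ∈ stabP Γ Z) {x : M} (hx : x ∈ Z.Z2) : g • x ∈ Z.Z2 := by
  rw [← ((mem_stabP_iff Z).mp hg).1]; exact Submodule.smul_mem_pointwise_smul _ _ _ hx

/-- `g ∈ P^ess_Z` maps `Z₋₁` into itself. [cite: Lan2013PELCompactifications, Def. 5.3.1.4 (pp. 348–349)] -/
theorem smul_mem_Z1_of_mem_stabP {g : Γ} (hg : g ∈ stabP Γ Z) {x : M} (hx : x ∈ Z.Z1) : g • x ∈ Z.Z1 := by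
  rw [← ((mem_stabP_iff Z).mp hg).2]; exact Submodule.smul_mem_pointwise_smul _ _ _ hx

/-- `(g n g⁻¹) v − v = g (n (g⁻¹ v) − g⁻¹ v)` (conjugation bookkeeping for the normality proofs). [cite: Lan2013PELCompactifications, Def. 5.3.1.11 (p. 349)] -/
theorem conj_smul_sub (g n : Γ) (v : M) : (g * n * g⁻¹) • v - v = g • (n • (g⁻¹ • v) - g⁻¹ • v) := by
  rw [smul_sub, smul_inv_smul, mul_smul, mul_smul]

end MemLemmas

/-- **Lemma 5.3.1.6, (5.3.1.7) holds**: `U^ess_2 ⊂ U^ess ⊂ Z^ess ⊂ P^ess ⊂ G^ess` (by definition). [cite: Lan2013PELCompactifications, Lem. 5.3.1.6 (5.3.1.7) (p. 349)] -/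
theorem Lan2013_5316_inclusions_holds : Lan2013_5316_inclusions := by
  intro A _ M _ _ Γ _ _ _ C _ ν Z
  exact ⟨fun g hg => ((mem_U2grp_iff ν Z).mp hg).1, fun g hg => ((mem_Uess_iff ν Z).mp hg).1,
    fun g hg => ((mem_Zess_iff ν Z).mp hg).1, le_top⟩

/-- **Def. 5.3.1.11, displayed inclusions and exact sequences hold**: the inclusions of the `H_{n,⊤}` and the three normalities (`Z^ess ⊲ P^ess`,
`U^ess ⊲ Z^ess`, `U^ess_2 ⊲ U^ess`, intersected with `H_n`). [cite: Lan2013PELCompactifications, Def. 5.3.1.11 (p. 349)] -/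
theorem Lan2013_53111_sequences_holds : Lan2013_53111_sequences := by
  intro A _ M _ _ Γ _ _ _ C _ ν Z Hn
  refine ⟨inf_le_inf_left Hn fun g hg => ((mem_U2grp_iff ν Z).mp hg).1,
    inf_le_inf_left Hn fun g hg => ((mem_Uess_iff ν Z).mp hg).1,
    inf_le_inf_left Hn fun g hg => ((mem_Zess_iff ν Z).mp hg).1, inf_le_left, ?_, ?_, ?_⟩
  · -- `H_{n,Z^ess}` is normal in `H_{n,P^ess}`
    refine ⟨fun n hn g => ?_⟩
    rw [Subgroup.mem_subgroupOf] at hn ⊢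
    have hgP : (g : Γ) ∈ stabP Γ Z := (Subgroup.mem_inf.mp g.2).2
    have hnZ : (n : Γ) ∈ Zess ν Z := (Subgroup.mem_inf.mp hn).2
    obtain ⟨hnP, hnν, hngr⟩ := (mem_Zess_iff ν Z).mp hnZ
    refine Subgroup.mem_inf.mpr ⟨?_, ?_⟩
    · exact Hn.mul_mem (Hn.mul_mem (Subgroup.mem_inf.mp g.2).1 (Subgroup.mem_inf.mp hn).1)
        (Hn.inv_mem (Subgroup.mem_inf.mp g.2).1)
    · refine (mem_Zess_iff ν Z).mpr ⟨?_, ?_, fun v hv => ?_⟩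
      · exact (stabP Γ Z).mul_mem ((stabP Γ Z).mul_mem hgP hnP) ((stabP Γ Z).inv_mem hgP)
      · simp only [Subgroup.coe_mul, Subgroup.coe_inv, map_mul, map_inv, hnν, mul_one, mul_inv_cancel]
      · rw [Subgroup.coe_mul, Subgroup.coe_mul, Subgroup.coe_inv, conj_smul_sub]
        have hgv : (g : Γ)⁻¹ • v ∈ Z.Z1 := smul_mem_Z1_of_mem_stabP Z ((stabP Γ Z).inv_mem hgP) hv
        exact smul_mem_Z2_of_mem_stabP Z hgP (hngr _ hgv)
  · -- `H_{n,U^ess}` is normal in `H_{n,Z^ess}`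
    refine ⟨fun n hn g => ?_⟩
    rw [Subgroup.mem_subgroupOf] at hn ⊢
    have hgZ : (g : Γ) ∈ Zess ν Z := (Subgroup.mem_inf.mp g.2).2
    have hgP : (g : Γ) ∈ stabP Γ Z := ((mem_Zess_iff ν Z).mp hgZ).1
    have hnU : (n : Γ) ∈ Uess ν Z := (Subgroup.mem_inf.mp hn).2
    obtain ⟨hnZ, hn2, hn0⟩ := (mem_Uess_iff ν Z).mp hnU
    refine Subgroup.mem_inf.mpr ⟨?_, ?_⟩
    · exact Hn.mul_mem (Hn.mul_mem (Subgroup.mem_inf.mp g.2).1 (Subgroup.mem_inf.mp hn).1)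
        (Hn.inv_mem (Subgroup.mem_inf.mp g.2).1)
    · refine (mem_Uess_iff ν Z).mpr ⟨?_, fun u hu => ?_, fun w => ?_⟩
      · exact (Zess ν Z).mul_mem ((Zess ν Z).mul_mem hgZ hnZ) ((Zess ν Z).inv_mem hgZ)
      · rw [Subgroup.coe_mul, Subgroup.coe_mul, Subgroup.coe_inv, mul_smul, mul_smul]
        have hgu : (g : Γ)⁻¹ • u ∈ Z.Z2 := smul_mem_Z2_of_mem_stabP Z ((stabP Γ Z).inv_mem hgP) hu
        rw [hn2 _ hgu, smul_inv_smul]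
      · rw [Subgroup.coe_mul, Subgroup.coe_mul, Subgroup.coe_inv, conj_smul_sub]
        exact smul_mem_Z1_of_mem_stabP Z hgP (hn0 _)
  · -- `H_{n,U^ess_2}` is normal in `H_{n,U^ess}`
    refine ⟨fun n hn g => ?_⟩
    rw [Subgroup.mem_subgroupOf] at hn ⊢
    have hgU : (g : Γ) ∈ Uess ν Z := (Subgroup.mem_inf.mp g.2).2
    obtain ⟨hgZ, hg2, hg0⟩ := (mem_Uess_iff ν Z).mp hgU
    have hgP : (g : Γ) ∈ stabP Γ Z := ((mem_Zess_iff ν Z).mp hgZ).1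
    have hnU2 : (n : Γ) ∈ U2grp ν Z := (Subgroup.mem_inf.mp hn).2
    obtain ⟨hnU, hn1, hn0⟩ := (mem_U2grp_iff ν Z).mp hnU2
    refine Subgroup.mem_inf.mpr ⟨?_, ?_⟩
    · exact Hn.mul_mem (Hn.mul_mem (Subgroup.mem_inf.mp g.2).1 (Subgroup.mem_inf.mp hn).1)
        (Hn.inv_mem (Subgroup.mem_inf.mp g.2).1)
    · refine (mem_U2grp_iff ν Z).mpr ⟨?_, fun v hv => ?_, fun w => ?_⟩
      · exact (Uess ν Z).mul_mem ((Uess ν Z).mul_mem hgU hnU) ((Uess ν Z).inv_mem hgU)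
      · rw [Subgroup.coe_mul, Subgroup.coe_mul, Subgroup.coe_inv, mul_smul, mul_smul]
        have hgv : (g : Γ)⁻¹ • v ∈ Z.Z1 := smul_mem_Z1_of_mem_stabP Z ((stabP Γ Z).inv_mem hgP) hv
        rw [hn1 _ hgv, smul_inv_smul]
      · rw [Subgroup.coe_mul, Subgroup.coe_mul, Subgroup.coe_inv, conj_smul_sub]
        have h2 : (n : Γ) • ((g : Γ)⁻¹ • w) - (g : Γ)⁻¹ • w ∈ Z.Z2 := hn0 _
        rw [hg2 _ h2]; exact h2


section Induced

variable {A : Type u} [CommRing A] {M : Type v} [AddCommGroup M] [Module A M]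
  {Γ : Type w} [Group Γ] [DistribMulAction Γ M] [SMulCommClass Γ A M]
  {C : Type u₁} [CommGroup C] (ν : Γ →* C) (Z : Filtration3 A M)

/-- Uniqueness of `Gr₋₁(g)`: two automorphisms of `Z₋₁/Z₋₂` induced by the same `g ∈ P^ess_Z` agree (classes `[v]` exhaust `Gr₋₁`).
[cite: Lan2013PELCompactifications, Lem. 5.3.1.6 (5.3.1.8) (p. 349)] -/
theorem isGrNeg1Of_unique {g : Γ} (hg : g ∈ stabP Γ Z) {e e' : Z.Gr1 ≃ₗ[A] Z.Gr1} (he : IsGrNeg1Of Z g e)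
    (he' : IsGrNeg1Of Z g e') : e = e' := by
  refine LinearEquiv.ext fun x => ?_
  obtain ⟨v, rfl⟩ := Submodule.mkQ_surjective _ x
  change e (mk1 Z v) = e' (mk1 Z v)
  rw [he v v.2 (smul_mem_Z1_of_mem_stabP Z hg v.2), he' v v.2 (smul_mem_Z1_of_mem_stabP Z hg v.2)]

/-- Uniqueness of `Gr₋₂(g)`. [cite: Lan2013PELCompactifications, Lem. 5.3.1.6 (5.3.1.9) (p. 349)] -/
theorem isGrNeg2Of_unique {g : Γ} (hg : g ∈ stabP Γ Z) {e e' : Z.Gr2 ≃ₗ[A] Z.Gr2} (he : IsGrNeg2Of Z g e)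
    (he' : IsGrNeg2Of Z g e') : e = e' := by
  refine LinearEquiv.ext fun x => ?_
  rw [he x x.2 (smul_mem_Z2_of_mem_stabP Z hg x.2), he' x x.2 (smul_mem_Z2_of_mem_stabP Z hg x.2)]

omit [SMulCommClass Γ A M] in
/-- Uniqueness of `Gr₀(g)`. [cite: Lan2013PELCompactifications, Lem. 5.3.1.6 (5.3.1.9) (p. 349)] -/
theorem isGr0Of_unique {g : Γ} {e e' : Z.Gr0 ≃ₗ[A] Z.Gr0} (he : IsGr0Of Z g e) (he' : IsGr0Of Z g e') : e = e' := by
  refine LinearEquiv.ext fun x => ?_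
  obtain ⟨w, rfl⟩ := Submodule.mkQ_surjective _ x
  exact (he w).trans (he' w).symm

/-- Existence of `Gr₋₂(g)` for `g ∈ P^ess_Z`: the restriction of `g` to `Z₋₂`, with inverse the restriction of `g⁻¹`.
[cite: Lan2013PELCompactifications, Lem. 5.3.1.6 (5.3.1.9) (p. 349)] -/
theorem exists_isGrNeg2Of {g : Γ} (hg : g ∈ stabP Γ Z) : ∃ e : Z.Gr2 ≃ₗ[A] Z.Gr2, IsGrNeg2Of Z g e := by
  let r : ∀ {g : Γ}, g ∈ stabP Γ Z → (Z.Gr2 →ₗ[A] Z.Gr2) := fun {g} hg =>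
    (DistribSMul.toLinearMap A M g).restrict fun _ hx => smul_mem_Z2_of_mem_stabP Z hg hx
  have r_coe : ∀ {g : Γ} (hg : g ∈ stabP Γ Z) (x : Z.Gr2), (r hg x : M) = g • (x : M) := fun _ _ => rfl
  refine ⟨LinearEquiv.ofLinear (r hg) (r ((stabP Γ Z).inv_mem hg)) ?_ ?_, fun u hu hgu => rfl⟩
  · ext x; simp [r_coe hg, r_coe ((stabP Γ Z).inv_mem hg)]
  · ext x; simp [r_coe hg, r_coe ((stabP Γ Z).inv_mem hg)]

/-- Existence of `Gr₀(g)` for `g ∈ P^ess_Z`: `Submodule.mapQ` of the action on `M/Z₋₁`, with inverse induced by `g⁻¹`.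
[cite: Lan2013PELCompactifications, Lem. 5.3.1.6 (5.3.1.9) (p. 349)] -/
theorem exists_isGr0Of {g : Γ} (hg : g ∈ stabP Γ Z) : ∃ e : Z.Gr0 ≃ₗ[A] Z.Gr0, IsGr0Of Z g e := by
  let q : ∀ {g : Γ}, g ∈ stabP Γ Z → (Z.Gr0 →ₗ[A] Z.Gr0) := fun {g} hg =>
    Z.Z1.mapQ Z.Z1 (DistribSMul.toLinearMap A M g) fun x hx => by simpa using smul_mem_Z1_of_mem_stabP Z hg hx
  have q_mk : ∀ {g : Γ} (hg : g ∈ stabP Γ Z) (x : M), q hg (mk0 Z x) = mk0 Z (g • x) := fun _ _ => rfl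
  have q_comp : ∀ {g h : Γ} (hg : g ∈ stabP Γ Z) (hh : h ∈ stabP Γ Z) (h1 : g * h = 1), q hg ∘ₗ q hh = LinearMap.id := by
    intro g h hg hh h1
    refine Submodule.linearMap_qext _ (LinearMap.ext fun x => ?_)
    simp only [LinearMap.comp_apply, Submodule.mkQ_apply, LinearMap.id_comp]
    change q hg (q hh (mk0 Z x)) = mk0 Z x
    rw [q_mk hh, q_mk hg, ← mul_smul, h1, one_smul]
  exact ⟨LinearEquiv.ofLinear (q hg) (q ((stabP Γ Z).inv_mem hg)) (q_comp hg ((stabP Γ Z).inv_mem hg) (mul_inv_cancel g))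
    (q_comp ((stabP Γ Z).inv_mem hg) hg (inv_mul_cancel g)), fun w => rfl⟩

/-- Existence of `Gr₋₁(g)` for `g ∈ P^ess_Z`: `Submodule.mapQ` of the restricted action on `Z₋₁/Z₋₂`, with inverse induced by `g⁻¹`.
[cite: Lan2013PELCompactifications, Lem. 5.3.1.6 (5.3.1.8) (p. 349)] -/
theorem exists_isGrNeg1Of {g : Γ} (hg : g ∈ stabP Γ Z) : ∃ e : Z.Gr1 ≃ₗ[A] Z.Gr1, IsGrNeg1Of Z g e := by
  let r : ∀ {g : Γ}, g ∈ stabP Γ Z → (↥Z.Z1 →ₗ[A] ↥Z.Z1) := fun {g} hg =>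
    (DistribSMul.toLinearMap A M g).restrict fun _ hx => smul_mem_Z1_of_mem_stabP Z hg hx
  have r_coe : ∀ {g : Γ} (hg : g ∈ stabP Γ Z) (x : ↥Z.Z1), (r hg x : M) = g • (x : M) := fun _ _ => rfl
  let q : ∀ {g : Γ}, g ∈ stabP Γ Z → (Z.Gr1 →ₗ[A] Z.Gr1) := fun {g} hg =>
    (Submodule.comap Z.Z1.subtype Z.Z2).mapQ (Submodule.comap Z.Z1.subtype Z.Z2) (r hg) fun x hx => by
      simp only [Submodule.mem_comap, Submodule.subtype_apply] at hx ⊢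
      rw [r_coe hg]
      exact smul_mem_Z2_of_mem_stabP Z hg hx
  have q_mk : ∀ {g : Γ} (hg : g ∈ stabP Γ Z) (x : ↥Z.Z1), q hg (mk1 Z x) = mk1 Z (r hg x) := fun _ _ => rfl
  have q_comp : ∀ {g h : Γ} (hg : g ∈ stabP Γ Z) (hh : h ∈ stabP Γ Z) (h1 : g * h = 1), q hg ∘ₗ q hh = LinearMap.id := by
    intro g h hg hh h1
    refine Submodule.linearMap_qext _ (LinearMap.ext fun x => ?_)
    simp only [LinearMap.comp_apply, Submodule.mkQ_apply, LinearMap.id_comp]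
    change q hg (q hh (mk1 Z x)) = mk1 Z x
    rw [q_mk hh, q_mk hg]
    congr 1
    ext
    rw [r_coe hg, r_coe hh, ← mul_smul, h1, one_smul]
  exact ⟨LinearEquiv.ofLinear (q hg) (q ((stabP Γ Z).inv_mem hg)) (q_comp hg ((stabP Γ Z).inv_mem hg) (mul_inv_cancel g))
    (q_comp ((stabP Γ Z).inv_mem hg) hg (inv_mul_cancel g)), fun v hv hgv => rfl⟩

end Induced

/-- **Lemma 5.3.1.6, (5.3.1.8) holds**: `Gr₋₁(g)` exists uniquely for `g ∈ P^ess_Z`, and `(Gr₋₁(g), ν(g)) = (Id, 1)` iff `g ∈ Z^ess_Z`.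
[cite: Lan2013PELCompactifications, Lem. 5.3.1.6 (5.3.1.8) (p. 349)] -/
theorem Lan2013_5316_exact_h_holds : Lan2013_5316_exact_h := by
  intro A _ M _ _ Γ _ _ _ C _ ν Z
  refine ⟨fun g hg => ?_, fun g hg => ⟨fun ⟨h1, hν⟩ => ?_, fun hZ => ⟨fun v hv hgv => ?_, ((mem_Zess_iff ν Z).mp hZ).2.1⟩⟩⟩
  · obtain ⟨e, he⟩ := exists_isGrNeg1Of Z hg
    exact ⟨e, he, fun e' he' => isGrNeg1Of_unique Z hg he' he⟩
  · refine (mem_Zess_iff ν Z).mpr ⟨hg, hν, fun v hv => ?_⟩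
    have h := h1 v hv (smul_mem_Z1_of_mem_stabP Z hg hv)
    rw [LinearEquiv.refl_apply] at h
    have h' := (Submodule.Quotient.eq _).mp h
    rw [Submodule.mem_comap] at h'
    have : v - g • v ∈ Z.Z2 := by simpa using h'
    simpa using Z.Z2.neg_mem this
  · rw [LinearEquiv.refl_apply]
    have h := ((mem_Zess_iff ν Z).mp hZ).2.2 v hv
    have : v - g • v ∈ Z.Z2 := by simpa using Z.Z2.neg_mem h
    refine (Submodule.Quotient.eq _).mpr ?_
    rw [Submodule.mem_comap]
    simpa using this

/-- **Lemma 5.3.1.6, (5.3.1.9) holds**: `Gr₋₂(g)`, `Gr₀(g)` exist uniquely for `g ∈ P^ess_Z`, and for `g ∈ Z^ess_Z` they are both the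
identity iff `g ∈ U^ess_Z`. [cite: Lan2013PELCompactifications, Lem. 5.3.1.6 (5.3.1.9) (p. 349)] -/
theorem Lan2013_5316_exact_l_holds : Lan2013_5316_exact_l := by
  intro A _ M _ _ Γ _ _ _ C _ ν Z
  refine ⟨fun g hg => ⟨?_, ?_⟩, fun g hgZ => ?_⟩
  · obtain ⟨e, he⟩ := exists_isGrNeg2Of Z hg
    exact ⟨e, he, fun e' he' => isGrNeg2Of_unique Z hg he' he⟩
  · obtain ⟨e, he⟩ := exists_isGr0Of Z hg
    exact ⟨e, he, fun e' he' => isGr0Of_unique Z he' he⟩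
  have hg : g ∈ stabP Γ Z := ((mem_Zess_iff ν Z).mp hgZ).1
  constructor
  · rintro ⟨h2, h0⟩
    refine (mem_Uess_iff ν Z).mpr ⟨hgZ, fun u hu => ?_, fun w => ?_⟩
    · have h := h2 u hu (smul_mem_Z2_of_mem_stabP Z hg hu)
      rw [LinearEquiv.refl_apply] at h
      exact (congrArg Subtype.val h).symm
    · have h := h0 w
      rw [LinearEquiv.refl_apply] at h
      have h' : w - g • w ∈ Z.Z1 := (Submodule.Quotient.eq _).mp h
      simpa using Z.Z1.neg_mem h'
  · intro hU
    obtain ⟨_, h2, h0⟩ := (mem_Uess_iff ν Z).mp hU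
    refine ⟨fun u hu hgu => Subtype.ext (by simpa using (h2 u hu).symm), fun w => ?_⟩
    rw [LinearEquiv.refl_apply]
    have : w - g • w ∈ Z.Z1 := by simpa using Z.Z1.neg_mem (h0 w)
    exact (Submodule.Quotient.eq _).mpr this


section Blocks

variable {A : Type u} [CommRing A] {M : Type v} [AddCommGroup M] [Module A M]
  {Γ : Type w} [Group Γ] [DistribMulAction Γ M] [SMulCommClass Γ A M]
  {C : Type u₁} [CommGroup C] (ν : Γ →* C) (Z : Filtration3 A M)

/-- The unipotent automorphism of a change of basis on a triple. [cite: Lan2013PELCompactifications, Def. 5.3.1.4 (pp. 348–349)] -/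
theorem changeOfBasis_apply (z : ChangeOfBasis Z) (a : Z.Gr2) (b : Z.Gr1) (c : Z.Gr0) :
    z.toLinearMap (a, b, c) = (a + z.z21 b + z.z20 c, b + z.z10 c, c) := rfl

/-- A change of basis is determined by its unipotent automorphism. [cite: Lan2013PELCompactifications, Def. 5.3.1.4 (pp. 348–349)] -/
theorem changeOfBasis_ext {z z' : ChangeOfBasis Z} (h : z.toLinearMap = z'.toLinearMap) : z = z' := by
  have h1 : ∀ b : Z.Gr1, z.z21 b = z'.z21 b := fun b => by
    have := congrArg (fun f : Z.Gr →ₗ[A] Z.Gr => (f (0, b, 0)).1) h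
    simpa [changeOfBasis_apply] using this
  have h2 : ∀ c : Z.Gr0, z.z10 c = z'.z10 c := fun c => by
    have := congrArg (fun f : Z.Gr →ₗ[A] Z.Gr => (f (0, 0, c)).2.1) h
    simpa [changeOfBasis_apply] using this
  have h3 : ∀ c : Z.Gr0, z.z20 c = z'.z20 c := fun c => by
    have := congrArg (fun f : Z.Gr →ₗ[A] Z.Gr => (f (0, 0, c)).1) h
    simpa [changeOfBasis_apply] using this
  obtain ⟨z21, z10, z20⟩ := z
  obtain ⟨z21', z10', z20'⟩ := z'
  simp only at h1 h2 h3
  rw [LinearMap.ext h1, LinearMap.ext h2, LinearMap.ext h3]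

/-- A splitting `δ` sends `(a, b, c)` to `a + δ(0, b, 0) + δ(0, 0, c)`. [cite: Lan2013PELCompactifications, Def. 5.2.2.10 (2010 rev. p. 335)] -/
theorem splitting_apply {δ : Z.Gr →ₗ[A] M} (hδ : Z.IsSplitting δ) (a : Z.Gr2) (b : Z.Gr1) (c : Z.Gr0) :
    δ (a, b, c) = (a : M) + δ (0, b, 0) + δ (0, 0, c) := by
  have hsum : ((a, b, c) : Z.Gr) = (a, 0, 0) + (0, b, 0) + (0, 0, c) := by simp
  rw [hsum, map_add, map_add]
  congr 1; congr 1
  exact hδ.2.1 a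

end Blocks

/-- **Lemma 5.3.1.6, (5.3.1.10) holds**: for `g ∈ U^ess_Z` and a splitting `δ`, the change of basis `ẑ = δ⁻¹ ∘ g ∘ δ` exists uniquely,
`(ẑ₂₁, ẑ₁₀) = 0` iff `g ∈ U^ess_{2,Z}`, and `ẑ₂₁ [v] = g v − v`, `ẑ₁₀ [w] = [g w − w]`.
[cite: Lan2013PELCompactifications, Lem. 5.3.1.6 (5.3.1.10) (p. 349)] -/
theorem Lan2013_5316_exact_u_holds : Lan2013_5316_exact_u := by
  intro A _ M _ _ Γ _ _ _ C _ ν Z δ hδ g hgU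
  obtain ⟨hgZ, hg2, hg0⟩ := (mem_Uess_iff ν Z).mp hgU
  obtain ⟨hgP, -, hg1⟩ := (mem_Zess_iff ν Z).mp hgZ
  obtain ⟨hbij, hδ2, hδ1, hδ0⟩ := hδ
  -- the three formulas valid for ANY block decomposition
  have key : ∀ z : ChangeOfBasis Z, IsBlockOf Z δ g z →
      (∀ v : ↥Z.Z1, ((z.z21 (mk1 Z v) : Z.Gr2) : M) = g • (v : M) - v) ∧
      (∀ (w : M) (hw : g • w - w ∈ Z.Z1), z.z10 (mk0 Z w) = mk1 Z ⟨g • w - w, hw⟩) := by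
    intro z hz
    have h21 : ∀ v : ↥Z.Z1, ((z.z21 (mk1 Z v) : Z.Gr2) : M) = g • (v : M) - v := by
      intro v
      have h := hz (0, mk1 Z v, 0)
      rw [changeOfBasis_apply] at h
      simp only [map_zero, add_zero, zero_add] at h
      rw [splitting_apply Z ⟨hbij, hδ2, hδ1, hδ0⟩ (z.z21 (mk1 Z v)) (mk1 Z v) 0] at h
      -- h : g • δ (0, mk1 v, 0) = z21 (mk1 v) + δ (0, mk1 v, 0) + δ (0, 0, 0)
      have hu : δ (0, mk1 Z v, 0) - (v : M) ∈ Z.Z2 := hδ1 v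
      set m := δ (0, mk1 Z v, 0) with hm
      have hgm : g • m = g • (v : M) + (m - v) := by
        rw [show m = (v : M) + (m - v) by abel, smul_add, hg2 _ hu]; abel_nf
      rw [hgm] at h
      have h0 : δ ((0 : Z.Gr2), (0 : Z.Gr1), (0 : Z.Gr0)) = 0 := by
        rw [show ((0 : Z.Gr2), (0 : Z.Gr1), (0 : Z.Gr0)) = (0 : Z.Gr) from rfl, map_zero]
      rw [h0, add_zero] at h
      -- h : g v + (m - v) = z21 + m
      have h' : ((z.z21 (mk1 Z v) : Z.Gr2) : M) = g • (v : M) + (m - v) - m := by rw [h]; abel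
      rw [h']; abel
    refine ⟨h21, fun w hw => ?_⟩
    have h := hz (0, 0, mk0 Z w)
    rw [changeOfBasis_apply] at h
    simp only [map_zero, zero_add] at h
    obtain ⟨v, hv⟩ := Submodule.mkQ_surjective _ (z.z10 (mk0 Z w))
    change mk1 Z v = z.z10 (mk0 Z w) at hv
    rw [← hv] at h ⊢
    rw [splitting_apply Z ⟨hbij, hδ2, hδ1, hδ0⟩ (z.z20 (mk0 Z w)) (mk1 Z v) (mk0 Z w)] at h
    -- h : g • δ (0,0,[w]) = z20 [w] + δ (0, [v], 0) + δ (0, 0, [w])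
    set x := δ (0, 0, mk0 Z w) with hx
    have hy : x - w ∈ Z.Z1 := hδ0 w
    have hu1 : δ (0, mk1 Z v, 0) - (v : M) ∈ Z.Z2 := hδ1 v
    have hgy : g • (x - w) - (x - w) ∈ Z.Z2 := hg1 _ hy
    -- from h: g x - x = z20 + δ(0,[v],0)
    have hdiff : g • x - x = ((z.z20 (mk0 Z w) : Z.Gr2) : M) + δ (0, mk1 Z v, 0) := by
      rw [h]; abel
    -- g w - w - v ∈ Z2
    have hmem : (g • w - w) - (v : M) ∈ Z.Z2 := by
      have e1 : (g • w - w) - (v : M) =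
          (g • x - x) - (g • (x - w) - (x - w)) - δ (0, mk1 Z v, 0) + (δ (0, mk1 Z v, 0) - v) := by
        rw [smul_sub]; abel
      rw [e1, hdiff]
      have e2 : ((z.z20 (mk0 Z w) : Z.Gr2) : M) + δ (0, mk1 Z v, 0) - (g • (x - w) - (x - w)) - δ (0, mk1 Z v, 0) +
          (δ (0, mk1 Z v, 0) - ↑v) = ((z.z20 (mk0 Z w) : Z.Gr2) : M) - (g • (x - w) - (x - w)) + (δ (0, mk1 Z v, 0) - ↑v) := by
        abel
      rw [e2]
      exact Z.Z2.add_mem (Z.Z2.sub_mem (z.z20 (mk0 Z w)).2 hgy) hu1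
    refine ((Submodule.Quotient.eq _).mpr ?_).symm
    rw [Submodule.mem_comap]
    simpa using hmem
  refine ⟨?_, fun z hz => ⟨?_, key z hz⟩⟩
  · -- existence and uniqueness of the block decomposition
    let e : Z.Gr ≃ₗ[A] M := LinearEquiv.ofBijective δ hbij
    let T : Z.Gr →ₗ[A] Z.Gr := e.symm.toLinearMap ∘ₗ (DistribSMul.toLinearMap A M g) ∘ₗ δ
    have hT : ∀ t, δ (T t) = g • δ t := fun t => by
      change δ (e.symm (g • δ t)) = g • δ t
      exact LinearEquiv.apply_ofBijective_symm_apply δ (h := hbij) _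
    have hTδ : ∀ t m, δ t = m → T (e.symm m) = e.symm (g • m) := fun t m htm => by
      change e.symm (g • δ (e.symm m)) = e.symm (g • m)
      rw [LinearEquiv.apply_ofBijective_symm_apply δ (h := hbij)]
    -- T on the three summands
    have hT2 : ∀ a : Z.Gr2, T (a, 0, 0) = (a, 0, 0) := fun a => by
      apply hbij.1
      rw [hT]
      have ha : δ ((a, 0, 0) : Z.Gr) = (a : M) := hδ2 a
      rw [ha, hg2 _ a.2]
    have hT1 : ∀ b : Z.Gr1, (T (0, b, 0)).2 = (b, 0) := fun b => by
      obtain ⟨y, rfl⟩ := Submodule.mkQ_surjective _ b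
      change (T (0, mk1 Z y, 0)).2 = (mk1 Z y, 0)
      set m := δ (0, mk1 Z y, 0) with hm
      have hu : m - (y : M) ∈ Z.Z2 := hδ1 y
      have hu' : g • (y : M) - y ∈ Z.Z2 := hg1 _ y.2
      have hgm : g • m = m + (g • (y : M) - y) := by
        rw [show m = (y : M) + (m - y) by abel, smul_add, hg2 _ hu]; abel
      have hval : T (0, mk1 Z y, 0) = (0, mk1 Z y, 0) + (⟨g • (y : M) - y, hu'⟩, 0, 0) := by
        apply hbij.1
        rw [hT, map_add, ← hm, hgm]
        congr 1
        exact (hδ2 ⟨g • (y : M) - y, hu'⟩).symm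
      rw [hval]
      simp
    have hT0 : ∀ c : Z.Gr0, (T (0, 0, c)).2.2 = c := fun c => by
      obtain ⟨w, rfl⟩ := Submodule.mkQ_surjective _ c
      change (T (0, 0, mk0 Z w)).2.2 = mk0 Z w
      set x := δ (0, 0, mk0 Z w) with hx
      have hy : x - w ∈ Z.Z1 := hδ0 w
      have hd : g • x - x ∈ Z.Z1 := by
        have e1 : g • x - x = (g • w - w) + (g • (x - w) - (x - w)) := by rw [smul_sub]; abel
        rw [e1]; exact Z.Z1.add_mem (hg0 w) (Z.le (hg1 _ hy))
      set d : ↥Z.Z1 := ⟨g • x - x, hd⟩ with hd'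
      have hu2 : δ (0, mk1 Z d, 0) - (d : M) ∈ Z.Z2 := hδ1 d
      have hval : T (0, 0, mk0 Z w) =
          (0, 0, mk0 Z w) + ((0, mk1 Z d, 0) - (⟨δ (0, mk1 Z d, 0) - (d : M), hu2⟩, 0, 0)) := by
        apply hbij.1
        rw [hT, map_add, map_sub, ← hx]
        have e2 : δ ((⟨δ (0, mk1 Z d, 0) - (d : M), hu2⟩ : Z.Gr2), (0 : Z.Gr1), (0 : Z.Gr0)) = δ (0, mk1 Z d, 0) - (d : M) :=
          hδ2 ⟨δ (0, mk1 Z d, 0) - (d : M), hu2⟩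
        rw [e2]
        have e3 : (d : M) = g • x - x := rfl
        rw [e3]; abel
      rw [hval]
      simp
    let z : ChangeOfBasis Z :=
      ⟨LinearMap.fst A Z.Gr2 (Z.Gr1 × Z.Gr0) ∘ₗ T ∘ₗ Z.incl1,
       (LinearMap.fst A Z.Gr1 Z.Gr0 ∘ₗ LinearMap.snd A Z.Gr2 (Z.Gr1 × Z.Gr0)) ∘ₗ T ∘ₗ Z.incl0,
       LinearMap.fst A Z.Gr2 (Z.Gr1 × Z.Gr0) ∘ₗ T ∘ₗ Z.incl0⟩
    have hz21 : ∀ b, z.z21 b = (T (0, b, 0)).1 := fun _ => rfl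
    have hz10 : ∀ c, z.z10 c = (T (0, 0, c)).2.1 := fun _ => rfl
    have hz20 : ∀ c, z.z20 c = (T (0, 0, c)).1 := fun _ => rfl
    have hTz : ∀ t, T t = z.toLinearMap t := by
      rintro ⟨a, b, c⟩
      have hsplit : T (a, b, c) = T (a, 0, 0) + T (0, b, 0) + T (0, 0, c) := by
        rw [← map_add, ← map_add]; congr 1; simp
      have e1 : T (0, b, 0) = ((T (0, b, 0)).1, b, 0) := Prod.ext rfl (hT1 b)
      have e0 : T (0, 0, c) = ((T (0, 0, c)).1, (T (0, 0, c)).2.1, c) :=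
        Prod.ext rfl (Prod.ext rfl (hT0 c))
      rw [hsplit, hT2, changeOfBasis_apply, e1, e0, hz21, hz10, hz20]
      simp only [Prod.mk_add_mk, add_zero, zero_add]
    have hzblock : IsBlockOf Z δ g z := fun t => by rw [← hTz, hT]
    refine ⟨z, hzblock, fun z' hz' => changeOfBasis_ext Z (LinearMap.ext fun t => hbij.1 ?_)⟩
    rw [← hTz, hT, hz' t]
  · -- (z21, z10) = 0 iff g ∈ U2grp
    obtain ⟨h21, h10⟩ := key z hz
    constructor
    · rintro ⟨hz21, hz10⟩
      refine (mem_U2grp_iff ν Z).mpr ⟨hgU, fun v hv => ?_, fun w => ?_⟩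
      · have h := h21 ⟨v, hv⟩
        rw [hz21, LinearMap.zero_apply] at h
        have : g • v - v = 0 := by simpa using h.symm
        exact sub_eq_zero.mp this
      · have h := h10 w (hg0 w)
        rw [hz10, LinearMap.zero_apply] at h
        have h' := (Submodule.Quotient.eq _).mp h.symm
        rw [Submodule.mem_comap] at h'
        simpa using h'
    · intro hU2
      obtain ⟨-, hfix, hsub⟩ := (mem_U2grp_iff ν Z).mp hU2
      constructor
      · refine LinearMap.ext fun b => ?_
        obtain ⟨v, rfl⟩ := Submodule.mkQ_surjective _ b
        apply Subtype.ext
        change ((z.z21 (mk1 Z v) : Z.Gr2) : M) = ((0 : Z.Gr2) : M)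
        rw [h21 v, hfix _ v.2, sub_self]; rfl
      · refine LinearMap.ext fun c => ?_
        obtain ⟨w, rfl⟩ := Submodule.mkQ_surjective _ c
        change z.z10 (mk0 Z w) = 0
        rw [h10 w (hg0 w)]
        refine (Submodule.Quotient.mk_eq_zero _).mpr ?_
        rw [Submodule.mem_comap]
        exact hsub w

section ActionLemmas

variable {A : Type u} [CommRing A] {M : Type v} [AddCommGroup M] [Module A M]
  {T₂ : Type u₂} [AddCommGroup T₂] [Module A T₂] {T₁ : Type u₃} [AddCommGroup T₁] [Module A T₁]
  {T₀ : Type u₄} [AddCommGroup T₀] [Module A T₀] {N : Type u₅} {E : Type u₁}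
  {Γ : Type w} [Group Γ] [DistribMulAction Γ M] [SMulCommClass Γ A M]
  {C : Type u₁} [CommGroup C] (ν : Γ →* C) [DistribMulAction C T₂] [SMulCommClass C A T₂] [MulAction C N]

/-- `x ∈ g⁻¹ • S ↔ g • x ∈ S` for the pointwise action on submodules. [cite: Lan2013PELCompactifications, Prop. 5.3.1.2 (p. 348)] -/
theorem mem_inv_smul_iff (g : Γ) (S : Submodule A M) (x : M) : x ∈ g⁻¹ • S ↔ g • x ∈ S := by
  constructor
  · intro hx
    obtain ⟨y, hy, rfl⟩ := (Submodule.mem_smul_pointwise_iff_exists _ _ _).mp hx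
    rw [smul_inv_smul]; exact hy
  · intro hx
    have := Submodule.smul_mem_pointwise_smul _ g⁻¹ _ hx
    rwa [inv_smul_smul] at this

omit [SMulCommClass C A T₂] in
/-- The rules of Prop. 5.3.1.2 for `g = 1` fix every datum. [cite: Lan2013PELCompactifications, Prop. 5.3.1.2 (p. 348)] -/
theorem isTranslate_one (a : LinearLevelDatum A M T₂ T₁ T₀ N E) : IsTranslate ν 1 a a := by
  refine ⟨by rw [inv_one, one_smul], by rw [inv_one, one_smul], fun x hx' hx => ?_, fun x hx' hx => ?_,
    by rw [map_one, inv_one, one_smul], fun x => by rw [one_smul], fun u hu' hu v hv' hv w => ?_, rfl⟩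
  · have e : (⟨(1 : Γ) • x, hx⟩ : ↥a.Z.Z2) = ⟨x, hx'⟩ := Subtype.ext (one_smul _ _)
    rw [e, map_one, one_smul]
  · have e : (⟨(1 : Γ) • x, hx⟩ : ↥a.Z.Z1) = ⟨x, hx'⟩ := Subtype.ext (one_smul _ _)
    rw [e]
  · have eu : (⟨(1 : Γ) • u, hu⟩ : ↥a.Z.Z2) = ⟨u, hu'⟩ := Subtype.ext (one_smul _ _)
    have ev : (⟨(1 : Γ) • v, hv⟩ : ↥a.Z.Z1) = ⟨v, hv'⟩ := Subtype.ext (one_smul _ _)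
    rw [one_smul, eu, ev, one_smul]

omit [SMulCommClass C A T₂] in
/-- Translating by `g` then by `h` is translating by `gh` (right action). [cite: Lan2013PELCompactifications, Prop. 5.3.1.2 (p. 348)] -/
theorem isTranslate_mul {g h : Γ} {a a' a'' : LinearLevelDatum A M T₂ T₁ T₀ N E} (h1 : IsTranslate ν g a a')
    (h2 : IsTranslate ν h a' a'') : IsTranslate ν (g * h) a a'' := by
  obtain ⟨hZ2', hZ1', hφ2', hφ1', hnu', hφ0', hδ', he'⟩ := h1
  obtain ⟨hZ2'', hZ1'', hφ2'', hφ1'', hnu'', hφ0'', hδ'', he''⟩ := h2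
  have hx2 : ∀ {x : M}, x ∈ a''.Z.Z2 → h • x ∈ a'.Z.Z2 := fun hx => by
    rw [hZ2''] at hx; exact (mem_inv_smul_iff h _ _).mp hx
  have hx1 : ∀ {x : M}, x ∈ a''.Z.Z1 → h • x ∈ a'.Z.Z1 := fun hx => by
    rw [hZ1''] at hx; exact (mem_inv_smul_iff h _ _).mp hx
  refine ⟨by rw [hZ2'', hZ2', smul_smul, ← mul_inv_rev], by rw [hZ1'', hZ1', smul_smul, ← mul_inv_rev],
    fun x hx' hx => ?_, fun x hx' hx => ?_, ?_, fun x => ?_, fun u hu' hu v hv' hv w => ?_, he''.trans he'⟩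
  · have hghx : g • (h • x) ∈ a.Z.Z2 := by rw [← mul_smul]; exact hx
    rw [hφ2'' x hx' (hx2 hx'), hφ2' (h • x) (hx2 hx') hghx, smul_smul, mul_comm, ← map_mul]
    congr 2
    exact Subtype.ext (mul_smul _ _ _).symm
  · have hghx : g • (h • x) ∈ a.Z.Z1 := by rw [← mul_smul]; exact hx
    rw [hφ1'' x hx' (hx1 hx'), hφ1' (h • x) (hx1 hx') hghx]
    congr 2
    exact Subtype.ext (mul_smul _ _ _).symm
  · rw [hnu'', hnu', smul_smul, ← mul_inv_rev, ← map_mul]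
  · rw [hφ0'' x, hφ0' (h • x), mul_smul]
  · have hghu : g • (h • u) ∈ a.Z.Z2 := by rw [← mul_smul]; exact hu
    have hghv : g • (h • v) ∈ a.Z.Z1 := by rw [← mul_smul]; exact hv
    rw [mul_smul, hδ'' u hu' (hx2 hu') v hv' (hx1 hv') w, hδ' (h • u) (hx2 hu') hghu (h • v) (hx1 hv') hghv (h • w)]
    have eu : (⟨g • h • u, hghu⟩ : ↥a.Z.Z2) = ⟨(g * h) • u, hu⟩ := Subtype.ext (mul_smul _ _ _).symm
    have ev : (⟨g • h • v, hghv⟩ : ↥a.Z.Z1) = ⟨(g * h) • v, hv⟩ := Subtype.ext (mul_smul _ _ _).symm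
    rw [eu, ev, ← mul_smul]

omit [SMulCommClass C A T₂] in
/-- The rules of Prop. 5.3.1.2 determine the translate. [cite: Lan2013PELCompactifications, Prop. 5.3.1.2 (p. 348)] -/
theorem isTranslate_unique {g : Γ} {a a' a'' : LinearLevelDatum A M T₂ T₁ T₀ N E} (h1 : IsTranslate ν g a a')
    (h2 : IsTranslate ν g a a'') : a' = a'' := by
  obtain ⟨⟨Z2', Z1', le'⟩, φ2', φ1', nu', φ0', δ', hs', e'⟩ := a'
  obtain ⟨⟨Z2'', Z1'', le''⟩, φ2'', φ1'', nu'', φ0'', δ'', hs'', e''⟩ := a''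
  obtain ⟨hZ2', hZ1', hφ2', hφ1', hnu', hφ0', hδ', he'⟩ := h1
  obtain ⟨hZ2'', hZ1'', hφ2'', hφ1'', hnu'', hφ0'', hδ'', he''⟩ := h2
  dsimp only at hZ2' hZ1' hφ2' hφ1' hnu' hφ0' hδ' he' hZ2'' hZ1'' hφ2'' hφ1'' hnu'' hφ0'' hδ'' he''
  subst hZ2' hZ1' hZ2'' hZ1''
  have memZ2 : ∀ {x : M}, x ∈ g⁻¹ • a.Z.Z2 → g • x ∈ a.Z.Z2 := fun hx => (mem_inv_smul_iff g _ _).mp hx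
  have memZ1 : ∀ {x : M}, x ∈ g⁻¹ • a.Z.Z1 → g • x ∈ a.Z.Z1 := fun hx => (mem_inv_smul_iff g _ _).mp hx
  have eφ2 : φ2' = φ2'' := by
    refine LinearEquiv.ext fun x => ?_
    rw [hφ2' x x.2 (memZ2 x.2), hφ2'' x x.2 (memZ2 x.2)]
  have eφ1 : φ1' = φ1'' := by
    refine LinearEquiv.ext fun x => ?_
    obtain ⟨y, rfl⟩ := Submodule.mkQ_surjective _ x
    exact (hφ1' y y.2 (memZ1 y.2)).trans (hφ1'' y y.2 (memZ1 y.2)).symm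
  have enu : nu' = nu'' := hnu'.trans hnu''.symm
  have eφ0 : φ0' = φ0'' := by
    refine LinearEquiv.ext fun x => ?_
    obtain ⟨w, rfl⟩ := Submodule.mkQ_surjective _ x
    exact (hφ0' w).trans (hφ0'' w).symm
  have eδ : δ' = δ'' := by
    refine LinearMap.ext fun t => ?_
    obtain ⟨u, b, c⟩ := t
    obtain ⟨y, rfl⟩ := Submodule.mkQ_surjective _ b
    obtain ⟨w, rfl⟩ := Submodule.mkQ_surjective _ c
    apply MulAction.injective g
    exact (hδ' u u.2 (memZ2 u.2) y y.2 (memZ1 y.2) w).trans (hδ'' u u.2 (memZ2 u.2) y y.2 (memZ1 y.2) w).symm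
  have ee : e' = e'' := he'.trans he''.symm
  subst eφ2 eφ1 enu eφ0 eδ ee
  rfl

/-- Existence of the translate of a linear level datum under `g` (the rules of Prop. 5.3.1.2 define an actual datum).
[cite: Lan2013PELCompactifications, Prop. 5.3.1.2 (p. 348)] -/
theorem exists_isTranslate (g : Γ) (a : LinearLevelDatum A M T₂ T₁ T₀ N E) :
    ∃ a' : LinearLevelDatum A M T₂ T₁ T₀ N E, IsTranslate ν g a a' := by
  have memZ2 : ∀ {x : M}, x ∈ g⁻¹ • a.Z.Z2 → g • x ∈ a.Z.Z2 := fun hx => (mem_inv_smul_iff g _ _).mp hx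
  have memZ1 : ∀ {x : M}, x ∈ g⁻¹ • a.Z.Z1 → g • x ∈ a.Z.Z1 := fun hx => (mem_inv_smul_iff g _ _).mp hx
  have memZ2' : ∀ {y : M}, y ∈ a.Z.Z2 → g⁻¹ • y ∈ g⁻¹ • a.Z.Z2 := fun hy => Submodule.smul_mem_pointwise_smul _ _ _ hy
  have memZ1' : ∀ {y : M}, y ∈ a.Z.Z1 → g⁻¹ • y ∈ g⁻¹ • a.Z.Z1 := fun hy => Submodule.smul_mem_pointwise_smul _ _ _ hy
  let Z' : Filtration3 A M := ⟨g⁻¹ • a.Z.Z2, g⁻¹ • a.Z.Z1, Submodule.map_mono a.Z.le⟩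
  -- `Gr₋₂(g) : Z'₋₂ ⥲ Z₋₂`
  let f2 : Z'.Gr2 →ₗ[A] a.Z.Gr2 := (DistribSMul.toLinearMap A M g).restrict fun _ hx => memZ2 hx
  let b2 : a.Z.Gr2 →ₗ[A] Z'.Gr2 := (DistribSMul.toLinearMap A M g⁻¹).restrict fun _ hy => memZ2' hy
  let e2 : Z'.Gr2 ≃ₗ[A] a.Z.Gr2 :=
    LinearEquiv.ofLinear f2 b2 (by ext y; simp [f2, b2]) (by ext x; simp [f2, b2])
  -- `Gr₋₁(g) : Z'₋₁/Z'₋₂ ⥲ Z₋₁/Z₋₂`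
  let r1 : ↥Z'.Z1 →ₗ[A] ↥a.Z.Z1 := (DistribSMul.toLinearMap A M g).restrict fun _ hx => memZ1 hx
  let s1 : ↥a.Z.Z1 →ₗ[A] ↥Z'.Z1 := (DistribSMul.toLinearMap A M g⁻¹).restrict fun _ hy => memZ1' hy
  let f1 : Z'.Gr1 →ₗ[A] a.Z.Gr1 :=
    (Submodule.comap Z'.Z1.subtype Z'.Z2).mapQ (Submodule.comap a.Z.Z1.subtype a.Z.Z2) r1 fun x hx => by
      simp only [Submodule.mem_comap, Submodule.subtype_apply] at hx ⊢
      exact memZ2 hx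
  let b1 : a.Z.Gr1 →ₗ[A] Z'.Gr1 :=
    (Submodule.comap a.Z.Z1.subtype a.Z.Z2).mapQ (Submodule.comap Z'.Z1.subtype Z'.Z2) s1 fun y hy => by
      simp only [Submodule.mem_comap, Submodule.subtype_apply] at hy ⊢
      exact memZ2' hy
  have f1_mk : ∀ x : ↥Z'.Z1, f1 (mk1 Z' x) = mk1 a.Z (r1 x) := fun _ => rfl
  have b1_mk : ∀ y : ↥a.Z.Z1, b1 (mk1 a.Z y) = mk1 Z' (s1 y) := fun _ => rfl
  have fb1 : f1 ∘ₗ b1 = LinearMap.id := by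
    refine Submodule.linearMap_qext _ (LinearMap.ext fun y => ?_)
    simp only [LinearMap.comp_apply, Submodule.mkQ_apply, LinearMap.id_comp]
    change f1 (b1 (mk1 a.Z y)) = mk1 a.Z y
    rw [b1_mk, f1_mk]
    congr 1; ext; simp [r1, s1]
  have bf1 : b1 ∘ₗ f1 = LinearMap.id := by
    refine Submodule.linearMap_qext _ (LinearMap.ext fun x => ?_)
    simp only [LinearMap.comp_apply, Submodule.mkQ_apply, LinearMap.id_comp]
    change b1 (f1 (mk1 Z' x)) = mk1 Z' x
    rw [f1_mk, b1_mk]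
    congr 1; ext; simp [r1, s1]
  let e1 : Z'.Gr1 ≃ₗ[A] a.Z.Gr1 := LinearEquiv.ofLinear f1 b1 fb1 bf1
  -- `Gr₀(g) : M/Z'₋₁ ⥲ M/Z₋₁`
  let f0 : Z'.Gr0 →ₗ[A] a.Z.Gr0 := Z'.Z1.mapQ a.Z.Z1 (DistribSMul.toLinearMap A M g) fun x hx => by
    simpa using memZ1 hx
  let b0 : a.Z.Gr0 →ₗ[A] Z'.Gr0 := a.Z.Z1.mapQ Z'.Z1 (DistribSMul.toLinearMap A M g⁻¹) fun y hy => by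
    simpa using memZ1' hy
  have f0_mk : ∀ x : M, f0 (mk0 Z' x) = mk0 a.Z (g • x) := fun _ => rfl
  have b0_mk : ∀ y : M, b0 (mk0 a.Z y) = mk0 Z' (g⁻¹ • y) := fun _ => rfl
  have fb0 : f0 ∘ₗ b0 = LinearMap.id := by
    refine Submodule.linearMap_qext _ (LinearMap.ext fun y => ?_)
    simp only [LinearMap.comp_apply, Submodule.mkQ_apply, LinearMap.id_comp]
    change f0 (b0 (mk0 a.Z y)) = mk0 a.Z y
    rw [b0_mk, f0_mk, smul_inv_smul]
  have bf0 : b0 ∘ₗ f0 = LinearMap.id := by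
    refine Submodule.linearMap_qext _ (LinearMap.ext fun x => ?_)
    simp only [LinearMap.comp_apply, Submodule.mkQ_apply, LinearMap.id_comp]
    change b0 (f0 (mk0 Z' x)) = mk0 Z' x
    rw [f0_mk, b0_mk, inv_smul_smul]
  let e0 : Z'.Gr0 ≃ₗ[A] a.Z.Gr0 := LinearEquiv.ofLinear f0 b0 fb0 bf0
  -- `Gr(g)` and the new splitting `δ' = g⁻¹ ∘ δ ∘ Gr(g)`
  let eGr : Z'.Gr ≃ₗ[A] a.Z.Gr := e2.prodCongr (e1.prodCongr e0)
  let ginv : M ≃ₗ[A] M := DistribMulAction.toLinearEquiv A M g⁻¹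
  let δ' : Z'.Gr →ₗ[A] M := ginv.toLinearMap ∘ₗ a.δ ∘ₗ eGr.toLinearMap
  have δ'_apply : ∀ t, δ' t = g⁻¹ • a.δ (eGr t) := fun _ => rfl
  have eGr_apply : ∀ (u : Z'.Gr2) (y : ↥Z'.Z1) (w : M),
      eGr (u, mk1 Z' y, mk0 Z' w) = (⟨g • (u : M), memZ2 u.2⟩, mk1 a.Z ⟨g • (y : M), memZ1 y.2⟩, mk0 a.Z (g • w)) :=
    fun _ _ _ => rfl
  obtain ⟨hbij, hδ2, hδ1, hδ0⟩ := a.isSplitting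
  have hs' : Z'.IsSplitting δ' := by
    refine ⟨ginv.bijective.comp (hbij.comp eGr.bijective), fun u => ?_, fun y => ?_, fun w => ?_⟩
    · change δ' (u, 0, 0) = (u : M)
      have h0 : ((u, 0, 0) : Z'.Gr) = (u, mk1 Z' 0, mk0 Z' 0) := by simp
      rw [δ'_apply, h0, eGr_apply]
      have : a.δ (⟨g • (u : M), memZ2 u.2⟩, mk1 a.Z ⟨g • ((0 : ↥Z'.Z1) : M), memZ1 (0 : ↥Z'.Z1).2⟩, mk0 a.Z (g • 0)) =
          g • (u : M) := by
        have e : (⟨g • ((0 : ↥Z'.Z1) : M), memZ1 (0 : ↥Z'.Z1).2⟩ : ↥a.Z.Z1) = 0 := Subtype.ext (by simp)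
        rw [e, smul_zero, map_zero, map_zero]
        exact hδ2 ⟨g • (u : M), memZ2 u.2⟩
      rw [this, inv_smul_smul]
    · change δ' (0, mk1 Z' y, 0) - (y : M) ∈ Z'.Z2
      have h0 : ((0, mk1 Z' y, 0) : Z'.Gr) = (0, mk1 Z' y, mk0 Z' 0) := by simp
      rw [δ'_apply, h0, eGr_apply]
      have e : (⟨g • ((0 : Z'.Gr2) : M), memZ2 (0 : Z'.Gr2).2⟩ : a.Z.Gr2) = 0 := Subtype.ext (by simp)
      rw [e, smul_zero, map_zero]
      have h1 := hδ1 ⟨g • (y : M), memZ1 y.2⟩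
      -- h1 : a.δ (incl1 [g y]) - g y ∈ Z2
      have : g⁻¹ • (a.δ (0, mk1 a.Z ⟨g • (y : M), memZ1 y.2⟩, 0) - g • (y : M)) ∈ g⁻¹ • a.Z.Z2 := memZ2' h1
      rwa [smul_sub, inv_smul_smul] at this
    · change δ' (0, 0, mk0 Z' w) - w ∈ Z'.Z1
      have h0 : ((0, 0, mk0 Z' w) : Z'.Gr) = (0, mk1 Z' 0, mk0 Z' w) := by simp
      rw [δ'_apply, h0, eGr_apply]
      have e : (⟨g • ((0 : Z'.Gr2) : M), memZ2 (0 : Z'.Gr2).2⟩ : a.Z.Gr2) = 0 := Subtype.ext (by simp)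
      have e' : (⟨g • ((0 : ↥Z'.Z1) : M), memZ1 (0 : ↥Z'.Z1).2⟩ : ↥a.Z.Z1) = 0 := Subtype.ext (by simp)
      rw [e, e', map_zero]
      have h1 := hδ0 (g • w)
      have : g⁻¹ • (a.δ (0, 0, mk0 a.Z (g • w)) - g • w) ∈ g⁻¹ • a.Z.Z1 := memZ1' h1
      rwa [smul_sub, inv_smul_smul] at this
  refine ⟨⟨Z', e2.trans (a.φneg2.trans (DistribMulAction.toLinearEquiv A T₂ (ν g))), e1.trans a.φneg1, (ν g)⁻¹ • a.nuφ,
    e0.trans a.φ0, δ', hs', a.extra⟩, rfl, rfl, fun x hx' hx => rfl, fun x hx' hx => rfl, rfl, fun x => rfl,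
    fun u hu' hu y hy' hy w => ?_, rfl⟩
  change g • δ' (⟨u, hu'⟩, mk1 Z' ⟨y, hy'⟩, mk0 Z' w) = _
  rw [δ'_apply, eGr_apply, smul_inv_smul]

end ActionLemmas

/-- **Proposition 5.3.1.2 ∕ 5.3.1.3 hold** (named fact `Lan2013_5312_action` discharged): the six printed rules define, for every
`g` and every linear level datum, a unique translate, and `g ↦ (α ↦ α ∘ g)` is a right action.
[cite: Lan2013PELCompactifications, Prop. 5.3.1.2 and Prop. 5.3.1.3 (p. 348)] -/
theorem Lan2013_5312_action_holds : Lan2013_5312_action := by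
  intro A _ M _ _ T₂ _ _ T₁ _ _ T₀ _ _ N E Γ _ _ _ C _ ν _ _ _
  refine ⟨fun g a => ?_, fun a => isTranslate_one ν a, fun g h a a' a'' h1 h2 => isTranslate_mul ν h1 h2⟩
  obtain ⟨a', ha'⟩ := exists_isTranslate ν g a
  exact ⟨a', ha', fun a'' ha'' => isTranslate_unique ν ha'' ha'⟩

end Literature.AlgebraicGeometry.ModuliOfAbelianVarieties.Lan2013.Sec53GeneralPELDegenerationData

end
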